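import Literature.Computability.Complexity.CHFractionBits
import Literature.Computability.Complexity.CHBlockResidues
import Literature.Computability.Complexity.CHCRRDigits
import HarnessLib

/-!
# From Chinese remainder representation to bits inside the counting hierarchy (Bürgisser's Thm. 3.4)

Toolkit file (theorems only) of the scaled-up `FOM + MAJ` calculus. **Theorem**
(`bitsOfResidues_mem_CH`; Bürgisser, ECCC TR06-113, Thm. 3.4, direction "`CR(a) ∈ CH ⇒ a`
definable in `CH`", whose printed proof scales up Hesse–Allender–Barrington's Thm. 4.1, JCSS 65
(2002), "there are Dlogtime-uniform threshold circuits … that on input the Chinese Remainder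
Representation of `0 ≤ X ≤ 2ⁿ` compute the binary representation of `X`"): if `X w < 2^{2^{t|w|}}`
and the residue function `⟨w, μ⟩ ↦ X w mod val μ` (prime `val μ`) has a `CH` graph, then the bit
language `{⟨w, s⟩ | bit (val s) of X w}` is in `CH`.

The proof is the parity form of HAB's conversion assembled from the toolkit: with `L = t(|w|)`,
`T = 2ᴸ`, blocks `A_b` (`1 ≤ b ≤ 2T`) of `4T` consecutive primes each (`CHPrimeCounting`,
`CHBlockResidues`), `B = ∏ A_b` and `Y_s = (2X+1) 2^{2T-1-s} ∏ (A_b+1)/2`, one has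
`⌊Y_s/B⌋ = ⌊X/2ˢ⌋` exactly, so bit `s` of `X` is the parity of `Y_s mod B`
(`CRRParity.mod_prod_mod_two_eq`); that parity is bit `R-1` of `K + 1 + ∑_q ⌊u_q 2ᴿ/q⌋` over the
`K = 8T²` base primes, `u_q` the CRT digits of `Y_s` (`CRRParity.testBit_fracSum_eq`,
`CHCRRDigits.digitGraph_mem_CH`), a long iterated sum whose bits are in `CH`
(`CHFractionBits.fracSumBit_mem_CH`).

## References

* P. Bürgisser, ECCC TR06-113 (2006), Thm. 3.4 and its proof.
* W. Hesse, E. Allender, D. A. M. Barrington, JCSS 65 (2002), §4, Lemmas 4.2–4.5, Thm. 4.1.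
-/

namespace Literature.Computability.Complexity

open _root_.Computability Polynomial PRelSigma TTClosure Brick PPSharpP ThresholdPP Plumb Finset

/-! ### The arithmetic core: bit `s` of `X` from the digits of `Y_s` -/

/-- `L + 3 ≤ 3 · 2ᴸ`. [folklore] -/
theorem add_three_le_three_mul_two_pow (L : ℕ) : L + 3 ≤ 3 * 2 ^ L := by
  induction L with
  | zero => norm_num
  | succ n ih => rw [pow_succ]; omega

/-- **The parity identity behind the conversion** (HAB 2002, Thm. 4.1 with Lemmas 4.3–4.4, in the
streamlined parity form of `CRRParity`): with `K' = 2^{L+2}`, `N = 2^{L+1}`, the base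
`P = p([K', K'(N+1)))` of `K'N` consecutive primes, its blocks `A_i = ∏ p([(i+1)K', (i+2)K'))`,
`Y = (2X+1) · 2^{N-1-s} · ∏_{i<N} (A_i+1)/2`, the digits `u_q = (Y mod q)·((2∏_{q'≠q} q') mod q)^{q-2} mod q`
and `R = (4L+11) K'N + 2L + 5`: for `s < 2ᴸ` and `X < 2^{2ᴸ}`,
bit `R - 1` of `∑_{q ∈ P} ⌊u_q 2ᴿ/q⌋ + |P| + 1` is bit `s` of `X`. [cite: HesseAllenderBarrington2002, Theorem 4.1] -/
theorem testBit_paritySum_eq (L s Xv : ℕ) (hs : s < 2 ^ L) (hX : Xv < 2 ^ 2 ^ L) :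
    ((∑ q ∈ (Ico (2 ^ (L + 2)) (2 ^ (L + 2) * (2 ^ (L + 1) + 1))).image (Nat.nth Nat.Prime),
        ((2 * Xv + 1) * 2 ^ (2 ^ (L + 1) - 1 - s) *
              (∏ i ∈ range (2 ^ (L + 1)),
                ((∏ q' ∈ (Ico ((i + 1) * 2 ^ (L + 2)) ((i + 2) * 2 ^ (L + 2))).image (Nat.nth Nat.Prime), q') + 1) / 2) % q *
            (((2 * ∏ q' ∈ ((Ico (2 ^ (L + 2)) (2 ^ (L + 2) * (2 ^ (L + 1) + 1))).image (Nat.nth Nat.Prime)).erase q, q') % q) ^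
              (q - 2) % q) % q * 2 ^ ((4 * L + 11) * 2 ^ (2 * L + 3) + 2 * L + 5) / q)) +
        (2 ^ (2 * L + 3) + 1)).testBit
        ((4 * L + 11) * 2 ^ (2 * L + 3) + 2 * L + 5 - 1) = Xv.testBit s := by
  set K' := 2 ^ (L + 2) with hK'
  set NB := 2 ^ (L + 1) with hNB
  set BP := (Ico K' (K' * (NB + 1))).image (Nat.nth Nat.Prime) with hBP
  set Ab : ℕ → ℕ := fun i => ∏ q' ∈ (Ico ((i + 1) * K') ((i + 2) * K')).image (Nat.nth Nat.Prime), q' with hAb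
  set R := (4 * L + 11) * 2 ^ (2 * L + 3) + 2 * L + 5 with hR
  have hK'1 : 1 ≤ K' := Nat.one_le_two_pow
  have hBPpr : ∀ q ∈ BP, q.Prime ∧ q % 2 = 1 := fun q hq => prime_and_odd_of_mem_image_nth hK'1 hq
  -- the card and the product of the base
  have hcard : BP.card = 2 ^ (2 * L + 3) := by
    rw [hBP, card_image_nth, hK', hNB, Nat.mul_succ, Nat.add_sub_cancel, ← pow_add]
    congr 1; ring
  have hsupply : K' * (NB + 1) ≤ Nat.primeCounting' (2 ^ (4 * L + 11)) :=
    (blockRange_le_two_pow L).trans (two_pow_le_primeCounting' L)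
  have hqlt : ∀ q ∈ BP, q < 2 ^ (4 * L + 11) := fun q hq => by
    obtain ⟨hq1, -, hq3⟩ := (mem_image_nth_iff _ _ _).1 hq
    exact lt_of_primeCounting'_lt hq1 hq3 hsupply
  have hBle : ∏ q ∈ BP, q ≤ (2 ^ (4 * L + 11)) ^ BP.card := prod_le_pow_card _ _ _ fun q hq => (hqlt q hq).le
  have hR2 : 2 * (∏ q ∈ BP, q) * (BP.card + 2) ≤ 2 ^ R := by
    rw [hcard] at hBle ⊢
    have hc2 : 2 ^ (2 * L + 3) + 2 ≤ 2 ^ (2 * L + 4) := by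
      have : 2 ≤ 2 ^ (2 * L + 3) :=
        calc (2:ℕ) = 2 ^ 1 := by norm_num
          _ ≤ 2 ^ (2 * L + 3) := Nat.pow_le_pow_right (by norm_num) (by omega)
      calc 2 ^ (2 * L + 3) + 2 ≤ 2 ^ (2 * L + 3) + 2 ^ (2 * L + 3) := by omega
        _ = 2 ^ (2 * L + 4) := by rw [← two_mul, ← pow_succ']
    calc 2 * (∏ q ∈ BP, q) * (2 ^ (2 * L + 3) + 2) ≤ 2 * (2 ^ (4 * L + 11)) ^ 2 ^ (2 * L + 3) * 2 ^ (2 * L + 4) :=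
          Nat.mul_le_mul (Nat.mul_le_mul_left _ hBle) hc2
      _ = 2 ^ R := by rw [hR, ← pow_mul, ← pow_succ', ← pow_add]; congr 1; ring
  -- the parity of `Y mod B` from the fraction sum
  rw [show 2 ^ (2 * L + 3) + 1 = BP.card + 1 by rw [hcard], ← add_assoc, CRRParity.testBit_fracSum_eq BP hBPpr _ R hR2]
  -- `B = ∏ Ab i` and the exact halving
  have hBeq : ∏ q ∈ BP, q = ∏ i ∈ range NB, Ab i := prod_image_nth_blocks K' NB
  have hodd : ∀ i < NB, Ab i % 2 = 1 := fun i _ =>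
    CRRParity.prod_primes_mod_two _ fun q hq => prime_and_odd_of_mem_image_nth
      (Nat.succ_le_of_lt (Nat.mul_pos (Nat.succ_pos i) (by omega))) hq
  have hbig : ∀ i < NB, 2 * NB * (2 * Xv + 1) < Ab i := fun i _ => by
    have h1 : 2 ^ K' ≤ Ab i := by
      have := two_pow_le_prod_image_nth ((i + 1) * K') ((i + 2) * K')
      rwa [show (i + 2) * K' - (i + 1) * K' = K' by rw [← Nat.sub_mul]; simp] at this
    refine lt_of_lt_of_le ?_ h1
    -- `2 NB (2X+1) < 2^{L+2} 2^{2^L+1} = 2^{2^L + L + 3} ≤ 2^{K'}`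
    have h2 : 2 * Xv + 1 < 2 ^ (2 ^ L + 1) := by rw [pow_succ]; omega
    have h3 : 2 * NB * (2 * Xv + 1) < 2 ^ (2 ^ L + L + 3) := by
      calc 2 * NB * (2 * Xv + 1) < 2 * NB * 2 ^ (2 ^ L + 1) := (Nat.mul_lt_mul_left (by rw [hNB]; positivity)).2 h2
        _ = 2 ^ (2 ^ L + L + 3) := by rw [hNB, ← pow_succ', ← pow_add]; congr 1; ring
    refine h3.trans_le (Nat.pow_le_pow_right (by norm_num) ?_)
    rw [hK', pow_add]
    have := add_three_le_three_mul_two_pow L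
    omega
  have hsNB : s + 2 ≤ NB := by rw [hNB, pow_succ]; have := Nat.one_le_two_pow (n := L); omega
  rw [hBeq, CRRParity.mod_prod_mod_two_eq Ab NB Xv s hsNB hodd hbig, Nat.testBit_eq_decide_div_mod_eq]

/-! ### The theorem -/

section Main

variable (t : Polynomial ℕ) {Xf ρ : List Bool → ℕ} {pρ : Polynomial ℕ}

/-- The numeral `R(w) = (4L+11) · 2^{2L+3} + 2L + 5` (`L = t(|w|)`) read off the first component
of `v = ⟨w, s⟩` is polynomial-time. [folklore] -/
theorem precisionFn_mem_FP :
    addFn ∘ pairFn (prodFn ∘ pairFn (lenBinF ∘ polyFn (4 * t + 11) ∘ fstP) ((fun w => Kannan.zerosFn (polyFn (2 * t + 3) w) ++ [true]) ∘ fstP))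
      (lenBinF ∘ polyFn (2 * t + 5) ∘ fstP) ∈ FP :=
  comp_mem_FP addFn_mem_FP (pairFn_mem_FP (comp_mem_FP prodFn_mem_FP (pairFn_mem_FP
    (comp_mem_FP lenBinF_mem_FP (comp_mem_FP (polyFn_mem_FP _) fstP_mem_FP)) (comp_mem_FP (pow2LenFn_mem_FP _) fstP_mem_FP)))
    (comp_mem_FP lenBinF_mem_FP (comp_mem_FP (polyFn_mem_FP _) fstP_mem_FP)))

/-- Its value. [folklore] -/
theorem bitsToNat_precisionFn (v : List Bool) :
    bitsToNat ((addFn ∘ pairFn (prodFn ∘ pairFn (lenBinF ∘ polyFn (4 * t + 11) ∘ fstP)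
        ((fun w => Kannan.zerosFn (polyFn (2 * t + 3) w) ++ [true]) ∘ fstP)) (lenBinF ∘ polyFn (2 * t + 5) ∘ fstP)) v) =
      (4 * t.eval (fstP v).length + 11) * 2 ^ (2 * t.eval (fstP v).length + 3) + 2 * t.eval (fstP v).length + 5 := by
  simp only [Function.comp_apply, pairFn_apply, addFn_boolPair, prodFn_boolPair, lenBinF_apply, bitsToNat_encodeNat,
    bitsToNat_pow2LenFn, eval_add, eval_mul, eval_ofNat]
  simp only [polyFn_apply, ones, List.length_replicate, eval_add, eval_mul, eval_ofNat]
  omega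

/-- The numeral `K + 1 = 2^{2L+3} + 1` read off the first component of `v` is polynomial-time. [folklore] -/
theorem cardSuccFn_mem_FP :
    addFn ∘ pairFn ((fun w => Kannan.zerosFn (polyFn (2 * t + 3) w) ++ [true]) ∘ fstP) (fun _ => encodeNat 1) ∈ FP :=
  comp_mem_FP addFn_mem_FP (pairFn_mem_FP (comp_mem_FP (pow2LenFn_mem_FP _) fstP_mem_FP) (const_mem_FP _))

/-- Its value. [folklore] -/
theorem bitsToNat_cardSuccFn (v : List Bool) :
    bitsToNat ((addFn ∘ pairFn ((fun w => Kannan.zerosFn (polyFn (2 * t + 3) w) ++ [true]) ∘ fstP) (fun _ => encodeNat 1)) v) =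
      2 ^ (2 * t.eval (fstP v).length + 3) + 1 := by
  simp only [Function.comp_apply, pairFn_apply, addFn_boolPair, bitsToNat_encodeNat, bitsToNat_pow2LenFn, eval_add, eval_mul, eval_ofNat]

/-- **Bürgisser's Theorem 3.4 (`CR ⇒ Bit`) / HAB's Theorem 4.1 scaled up to `CH`**: if
`X w < 2^{2^{t|w|}}` and the residue function `ρ ⟨w, μ⟩ = X w mod val μ` (for prime `val μ`) has a
`CH` graph and polynomial bit-size, then `{⟨w, s⟩ | bit (val s) of X w is 1} ∈ CH`
("It was shown by Hesse et al. [14, Theorem 4.1] that there are Dlogtime-uniform threshold circuits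
of polynomial size and depth bounded by a constant `D` that on input the Chinese Remainder
Representation of `0 ≤ X ≤ 2ⁿ` compute the binary representation of `X` … we conclude that
`L_d ∈ C_{s+d}P`", Bürgisser 2006, proof of Thm. 3.4). [cite: Burgisser2006, Theorem 3.4] -/
theorem bitsOfResidues_mem_CH (hXb : ∀ w, Xf w < 2 ^ 2 ^ t.eval w.length)
    (hρ : {z | ρ (fstP z) = bitsToNat (sndP z)} ∈ CH) (hρb : ∀ u, ρ u < 2 ^ pρ.eval u.length)
    (hρX : ∀ (w μ : List Bool), (bitsToNat μ).Prime → ρ (boolPair w μ) = Xf w % bitsToNat μ) :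
    {z | (Xf (fstP z)).testBit (bitsToNat (sndP z)) = true} ∈ CH := by
  classical
  obtain ⟨C, hC, hCb, hCeq⟩ := exists_cofactorRes t
  obtain ⟨Pp, hPp, hPpb, hPpeq⟩ := exists_halfSuccRes t
  -- the digit function
  set U : List Bool → ℕ := fun r =>
    ((2 * ρ (boolPair (fstP (fstP r)) (sndP r)) + 1) * Pp (boolPair (boolPair (fstP (fstP r)) (sndP r)) (sndP r)) *
          (if bitsToNat (sndP r) ≤ 1 then 0
            else 2 ^ (2 ^ (t.eval (fstP (fstP r)).length + 1) - 1 - bitsToNat (sndP (fstP r))) % bitsToNat (sndP r)) % bitsToNat (sndP r)) *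
        (if bitsToNat (sndP r) ≤ 1 then 0
          else (2 * C (boolPair (boolPair (fstP (fstP r)) (sndP r)) (sndP r)) % bitsToNat (sndP r)) ^ (bitsToNat (sndP r) - 2) % bitsToNat (sndP r)) %
        bitsToNat (sndP r) with hU
  have hUg : {z | U (fstP z) = bitsToNat (sndP z)} ∈ CH := digitGraph_mem_CH t hρ hρb hPp hPpb hC hCb
  have hUb : ∀ r, U r < 2 ^ (X : Polynomial ℕ).eval r.length := fun r => digit_lt_two_pow t ρ Pp C r
  -- the base primes
  set Bset : Language Bool := {r | (bitsToNat (sndP r)).Prime ∧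
      2 ^ (t.eval (fstP (fstP r)).length + 2) ≤ Nat.primeCounting' (bitsToNat (sndP r)) ∧
      Nat.primeCounting' (bitsToNat (sndP r)) < 2 ^ (t.eval (fstP (fstP r)).length + 2) * (2 ^ (t.eval (fstP (fstP r)).length + 1) + 1)}
    with hBset
  have hB : Bset ∈ CH := basePrimeThird_mem_CH t
  have hBU : ∀ r ∈ Bset, bitsToNat (sndP r) % 2 = 1 ∧ U r < bitsToNat (sndP r) := fun r hr => by
    obtain ⟨hq, hlo, hhi⟩ := hr
    refine ⟨(prime_and_odd_of_mem_image_nth Nat.one_le_two_pow ((mem_image_nth_iff _ _ _).2 ⟨hq, hlo, hhi⟩)).2, ?_⟩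
    exact digit_lt_modulus t ρ Pp C r hq.two_le
  -- the parity bit of the fraction sum
  have hPar := fracSumBit_mem_CH (Bset := Bset) hUg hUb (precisionFn_mem_FP t) (cardSuccFn_mem_FP t) hB hBU (4 * t + 11)
  -- the range test `val s < 2^{t|w|}`
  have hLt : (pairFn sndP ((fun w => Kannan.zerosFn (polyFn t w) ++ [true]) ∘ fstP) ⁻¹'
      ({u | bitsToNat (fstP u) < bitsToNat (sndP u)} : Language Bool)) ∈ Classes.P :=
    preimage_mem_P ltVal_mem_P (pairFn_mem_FP sndP_mem_FP (comp_mem_FP (pow2LenFn_mem_FP t) fstP_mem_FP))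
  refine mem_CH_of_iff (inter_P_mem_CH hLt hPar) _ fun z => ?_
  rw [memL_inf']
  change (Xf (fstP z)).testBit (bitsToNat (sndP z)) = true ↔
    bitsToNat (fstP (pairFn sndP ((fun w => Kannan.zerosFn (polyFn t w) ++ [true]) ∘ fstP) z)) <
      bitsToNat (sndP (pairFn sndP ((fun w => Kannan.zerosFn (polyFn t w) ++ [true]) ∘ fstP) z)) ∧
    ((bitsToNat ((addFn ∘ pairFn ((fun w => Kannan.zerosFn (polyFn (2 * t + 3) w) ++ [true]) ∘ fstP) (fun _ => encodeNat 1)) z) +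
        ∑ q ∈ (range (2 ^ (4 * t + 11 : Polynomial ℕ).eval z.length)).filter (fun q => 0 < q ∧ boolPair z (encodeNat q) ∈ Bset),
          U (boolPair z (encodeNat q)) *
            2 ^ bitsToNat ((addFn ∘ pairFn (prodFn ∘ pairFn (lenBinF ∘ polyFn (4 * t + 11) ∘ fstP)
              ((fun w => Kannan.zerosFn (polyFn (2 * t + 3) w) ++ [true]) ∘ fstP)) (lenBinF ∘ polyFn (2 * t + 5) ∘ fstP)) z) / q).testBit
      (bitsToNat ((addFn ∘ pairFn (prodFn ∘ pairFn (lenBinF ∘ polyFn (4 * t + 11) ∘ fstP)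
              ((fun w => Kannan.zerosFn (polyFn (2 * t + 3) w) ++ [true]) ∘ fstP)) (lenBinF ∘ polyFn (2 * t + 5) ∘ fstP)) z) - 1) = true)
  rw [bitsToNat_precisionFn, bitsToNat_cardSuccFn]
  simp only [pairFn_apply, Function.comp_apply, fstP_boolPair, sndP_boolPair, bitsToNat_pow2LenFn]
  -- notation
  set w := fstP z with hw
  set s := bitsToNat (sndP z) with hs
  set L := t.eval w.length with hL
  by_cases hsT : s < 2 ^ L
  swap
  · -- beyond the size bound the bit is `0`
    rw [Nat.testBit_lt_two_pow ((hXb w).trans_le (Nat.pow_le_pow_right (by norm_num) (not_lt.1 hsT)))]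
    simp only [hsT, false_and, iff_false]
    exact Bool.false_ne_true
  simp only [hsT, true_and]
  -- the base set is the block of primes `p([K', K'(NB+1)))`
  have hfilter : (range (2 ^ (4 * t + 11 : Polynomial ℕ).eval z.length)).filter (fun q => 0 < q ∧ boolPair z (encodeNat q) ∈ Bset) =
      (Ico (2 ^ (L + 2)) (2 ^ (L + 2) * (2 ^ (L + 1) + 1))).image (Nat.nth Nat.Prime) := by
    rw [← filter_range_eq_image_nth (N := 2 ^ (4 * t + 11 : Polynomial ℕ).eval z.length)]
    · refine filter_congr fun q _ => ?_
      rw [hBset]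
      change (0 < q ∧ ((bitsToNat (sndP (boolPair z (encodeNat q)))).Prime ∧ _ ∧ _)) ↔ _
      simp only [fstP_boolPair, sndP_boolPair, bitsToNat_encodeNat]
      exact ⟨fun h => h.2, fun h => ⟨h.1.pos, h⟩⟩
    · have := blockRange_le_primeCounting' t (length_fstP_le z) (le_refl (2 ^ (t.eval (fstP z).length + 1)))
      rwa [mul_comm] at this
  rw [hfilter]
  -- the digits on the base primes
  have hdigit : ∀ q ∈ (Ico (2 ^ (L + 2)) (2 ^ (L + 2) * (2 ^ (L + 1) + 1))).image (Nat.nth Nat.Prime),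
      U (boolPair z (encodeNat q)) =
        (2 * Xf w + 1) * 2 ^ (2 ^ (L + 1) - 1 - s) *
              (∏ i ∈ range (2 ^ (L + 1)),
                ((∏ q' ∈ (Ico ((i + 1) * 2 ^ (L + 2)) ((i + 2) * 2 ^ (L + 2))).image (Nat.nth Nat.Prime), q') + 1) / 2) % q *
            (((2 * ∏ q' ∈ ((Ico (2 ^ (L + 2)) (2 ^ (L + 2) * (2 ^ (L + 1) + 1))).image (Nat.nth Nat.Prime)).erase q, q') % q) ^
              (q - 2) % q) % q := fun q hq => by
    obtain ⟨hqp, hqodd⟩ := prime_and_odd_of_mem_image_nth Nat.one_le_two_pow hq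
    have hq2 := hqp.two_le
    rw [hU]
    simp only [fstP_boolPair, sndP_boolPair, bitsToNat_encodeNat]
    rw [if_neg (by omega), if_neg (by omega), hρX w _ (by rwa [bitsToNat_encodeNat]),
      hPpeq w _ (by rwa [bitsToNat_encodeNat]) (by rwa [bitsToNat_encodeNat]), hCeq w _ _ (by rwa [bitsToNat_encodeNat])]
    simp only [bitsToNat_encodeNat]
    congr 1
    congr 1
    · have h : (2 * (Xf w % q) + 1) * ((∏ i ∈ range (2 ^ (L + 1)),
          ((∏ q' ∈ (Ico ((i + 1) * 2 ^ (L + 2)) ((i + 2) * 2 ^ (L + 2))).image (Nat.nth Nat.Prime), q') + 1) / 2) % q) *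
          (2 ^ (2 ^ (L + 1) - 1 - s) % q) ≡
          (2 * Xf w + 1) * (∏ i ∈ range (2 ^ (L + 1)),
          ((∏ q' ∈ (Ico ((i + 1) * 2 ^ (L + 2)) ((i + 2) * 2 ^ (L + 2))).image (Nat.nth Nat.Prime), q') + 1) / 2) *
          2 ^ (2 ^ (L + 1) - 1 - s) [MOD q] :=
        ((((Nat.mod_modEq _ q).mul_left 2).add_right 1).mul (Nat.mod_modEq _ q)).mul (Nat.mod_modEq _ q)
      refine Eq.trans h ?_
      congr 1; ring
    · rw [Nat.mul_mod 2 (_ % q), Nat.mod_mod, ← Nat.mul_mod]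
  rw [sum_congr rfl fun q hq => by rw [hdigit q hq], add_comm, testBit_paritySum_eq L s (Xf w) hsT (hXb w)]

end Main

end Literature.Computability.Complexity
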